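import Mathlib.RingTheory.LaurentSeries
import Mathlib.RingTheory.PowerSeries.Expand
import Mathlib.FieldTheory.Finite.Basic
import Mathlib.FieldTheory.Perfect
import Mathlib.LinearAlgebra.Dimension.Finrank
import Mathlib.LinearAlgebra.Dimension.Constructions
import Mathlib.LinearAlgebra.FiniteDimensional.Defs
import HarnessLib

/-!
# `DescentPerfectToAll` (stmt-ResolutionOfSingularities-0549): the `p`-degree of `𝔽_p((X))` and its
# perfect subfields — field-theoretic inputs for an inhabitant of the residual class

Route `ResolutionOfSingularities/Descent`, crux `DescentPerfectToAll`. Helper (OURS; not a statement of any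
manuscript; `--supports` the crux, does not close it). The master class of resolvable ground fields of
`DescentDescentPerfectToAllExhaustion.lean` («EFT-separably exhausted» fields) is complemented by the residual
class of `descentPerfectToAll_iff_residual`; its standard informal inhabitant is the Laurent series field
`𝔽_p((X))`. This file proves the two elementary facts about `K = (ZMod p)⸨X⸩` that the witness needs
(`DescentDescentPerfectToAllResidualWitness.lean` assembles them):

* `powerSeries_pow_char_eq_expand`, `powerSeries_eq_sum_X_pow_mul_pow` — over `𝔽_p`, `φ^p = φ(X^p)`
  (Mathlib `MvPowerSeries.map_frobenius_expand`), hence the `p`-DIGIT EXPANSION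
  `g = ∑_{e<p} X^e · g_e^p`, `g_e = ∑_i g_{pi+e} X^i`;
* `laurentSeries_mem_span_frobenius`, `card_le_of_linearIndependent_frobenius_laurentSeries` —
  **`[K : K^p] ≤ p`**: `K` is spanned over `K^p = (frobenius K p).fieldRange` by `1, X, …, X^{p-1}`, so
  every `K^p`-linearly independent finite family in `K` has at most `p` members (`p`-rank `≤ 1`);
* `laurentSeries_order_eq_zero_of_forall_pow`, `laurentSeries_eq_C_of_forall_pow`,
  `laurentSeries_ringHom_eq_C_of_perfectField` — **the perfect subfields of `K` are trivial**: an
  element with `p^n`-th roots for all `n` has order divisible by every `p^n`, hence order `0`, and then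
  equals its constant term; so every ring map from a perfect field into `K` lands in the prime field.

[cite: Matsumura1987, §26 pp. 201–203 (p-bases; `[k((X)) : k((X))^p] = p` for perfect `k`)] [folklore]
-/

noncomputable section

set_option linter.dupNamespace false -- mandated namespace of this single-conjunct summit

open PowerSeries

namespace Summit.ResolutionOfSingularities.ResolutionOfSingularities.Theorems

variable (p : ℕ) [Fact p.Prime]

/-! ## `p`-digits of a power series over `𝔽_p` -/

/-- Over `𝔽_p` the Frobenius of `𝔽_p⟦X⟧` is the substitution `X ↦ X^p`: `φ ^ p = expand p φ`
(Mathlib's `MvPowerSeries.map_frobenius_expand` with `frobenius 𝔽_p = id`). [folklore] -/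
theorem powerSeries_pow_char_eq_expand (φ : (ZMod p)⟦X⟧) :
    φ ^ p = PowerSeries.expand p (Fact.out : p.Prime).ne_zero φ := by
  haveI : ExpChar (ZMod p) p := ExpChar.prime Fact.out
  have h := MvPowerSeries.map_frobenius_expand p (Fact.out : p.Prime).ne_zero (f := φ)
  rw [ZMod.frobenius_zmod, MvPowerSeries.map_id] at h
  exact h.symm

/-- **`p`-digit expansion in `𝔽_p⟦X⟧`**: `g = ∑_{e<p} X^e · g_e^p` with `g_e = ∑_i g_{pi+e} X^i`
(so `𝔽_p⟦X⟧` is spanned over its subring of `p`-th powers by `1, X, …, X^{p-1}`).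
[cite: Matsumura1987, §30 p. 243 (p-monomial expansion of `k⟦X⟧`)] -/
theorem powerSeries_eq_sum_X_pow_mul_pow (g : (ZMod p)⟦X⟧) :
    g = ∑ e : Fin p, X ^ (e : ℕ) * (PowerSeries.mk fun i => coeff (p * i + e) g) ^ p := by
  have hp : p.Prime := Fact.out
  ext n
  simp_rw [map_sum, powerSeries_pow_char_eq_expand p, coeff_X_pow_mul', PowerSeries.coeff_expand,
    coeff_mk]
  rw [Finset.sum_eq_single (⟨n % p, Nat.mod_lt n hp.pos⟩ : Fin p)]
  · rw [if_pos (Nat.mod_le n p), if_pos (Nat.dvd_sub_mod n),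
      Nat.mul_div_cancel' (Nat.dvd_sub_mod n), Nat.sub_add_cancel (Nat.mod_le n p)]
  · intro e _ hne
    split_ifs with h1 h2
    · exfalso
      apply hne
      ext
      have h3 : (e : ℕ) % p = n % p := (Nat.modEq_iff_dvd' h1).mpr h2
      rw [Nat.mod_eq_of_lt e.2] at h3
      exact h3
    · rfl
    · rfl
  · intro h
    exact absurd (Finset.mem_univ _) h

/-! ## `[𝔽_p((X)) : 𝔽_p((X))^p] ≤ p` -/

/-- **`𝔽_p((X))` is spanned over `𝔽_p((X))^p` by `1, X, …, X^{p-1}`**: write `f = a/b = (a b^{p-1}) · (b⁻¹)^p`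
and expand `a b^{p-1}` in `p`-digits. [cite: Matsumura1987, §26 pp. 201–203] -/
theorem laurentSeries_mem_span_frobenius [ExpChar (LaurentSeries (ZMod p)) p]
    (f : LaurentSeries (ZMod p)) :
    f ∈ Submodule.span (frobenius (LaurentSeries (ZMod p)) p).fieldRange
      (Set.range fun e : Fin p => (HahnSeries.single (1 : ℤ) (1 : ZMod p)) ^ (e : ℕ)) := by
  classical
  have hp : p.Prime := Fact.out
  obtain ⟨a, b, hb, hf⟩ := IsFractionRing.div_surjective (A := (ZMod p)⟦X⟧) f
  set B : LaurentSeries (ZMod p) := algebraMap (ZMod p)⟦X⟧ (LaurentSeries (ZMod p)) b with hB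
  have hB0 : B ≠ 0 := IsFractionRing.to_map_ne_zero_of_mem_nonZeroDivisors hb
  set g : (ZMod p)⟦X⟧ := a * b ^ (p - 1) with hg
  have hBp : B ^ p = B ^ (p - 1) * B := (pow_sub_one_mul hp.ne_zero B).symm
  have hfg : f = algebraMap (ZMod p)⟦X⟧ (LaurentSeries (ZMod p)) g * (B⁻¹) ^ p := by
    rw [← hf, hg, map_mul, map_pow, ← hB]
    calc algebraMap (ZMod p)⟦X⟧ (LaurentSeries (ZMod p)) a / B
        = algebraMap (ZMod p)⟦X⟧ (LaurentSeries (ZMod p)) a * B⁻¹ := div_eq_mul_inv _ _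
      _ = algebraMap (ZMod p)⟦X⟧ (LaurentSeries (ZMod p)) a * (B ^ (p - 1) * (B ^ (p - 1))⁻¹) * B⁻¹ := by
          rw [mul_inv_cancel₀ (pow_ne_zero _ hB0), mul_one]
      _ = algebraMap (ZMod p)⟦X⟧ (LaurentSeries (ZMod p)) a * B ^ (p - 1) * ((B ^ (p - 1))⁻¹ * B⁻¹) := by
          ring
      _ = algebraMap (ZMod p)⟦X⟧ (LaurentSeries (ZMod p)) a * B ^ (p - 1) * (B⁻¹) ^ p := by
          rw [← mul_inv, ← hBp, inv_pow]
  -- the `p`-digit expansion of `g`, pushed to `𝔽_p((X))`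
  set c : Fin p → (ZMod p)⟦X⟧ := fun e => PowerSeries.mk fun i => coeff (p * i + e) g with hc
  have hgK : algebraMap (ZMod p)⟦X⟧ (LaurentSeries (ZMod p)) g =
      ∑ e : Fin p, (HahnSeries.single (1 : ℤ) (1 : ZMod p)) ^ (e : ℕ) *
        (algebraMap (ZMod p)⟦X⟧ (LaurentSeries (ZMod p)) (c e)) ^ p := by
    conv_lhs => rw [powerSeries_eq_sum_X_pow_mul_pow p g]
    rw [map_sum]
    refine Finset.sum_congr rfl fun e _ => ?_
    rw [map_mul, map_pow, map_pow, LaurentSeries.coe_algebraMap, HahnSeries.ofPowerSeries_X]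
  rw [hfg, hgK, Finset.sum_mul]
  refine Submodule.sum_mem _ fun e _ => ?_
  have hmem : (algebraMap (ZMod p)⟦X⟧ (LaurentSeries (ZMod p)) (c e) * B⁻¹) ^ p ∈
      (frobenius (LaurentSeries (ZMod p)) p).fieldRange :=
    RingHom.mem_fieldRange.mpr ⟨algebraMap (ZMod p)⟦X⟧ (LaurentSeries (ZMod p)) (c e) * B⁻¹, rfl⟩
  have hterm : (HahnSeries.single (1 : ℤ) (1 : ZMod p)) ^ (e : ℕ) *
        (algebraMap (ZMod p)⟦X⟧ (LaurentSeries (ZMod p)) (c e)) ^ p * (B⁻¹) ^ p =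
      (⟨_, hmem⟩ : (frobenius (LaurentSeries (ZMod p)) p).fieldRange) •
        (HahnSeries.single (1 : ℤ) (1 : ZMod p)) ^ (e : ℕ) := by
    rw [Subfield.smul_def, smul_eq_mul]
    ring
  rw [hterm]
  exact Submodule.smul_mem _ _ (Submodule.subset_span ⟨e, rfl⟩)

/-- **`p`-rank of `𝔽_p((X))` is at most one**: every finite family in `K = 𝔽_p((X))` that is linearly
independent over `K^p` has at most `p` members (`[K : K^p] ≤ p`). [cite: Matsumura1987, §26 pp. 201–203] -/
theorem card_le_of_linearIndependent_frobenius_laurentSeries [ExpChar (LaurentSeries (ZMod p)) p]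
    {ι : Type*} [Fintype ι] (v : ι → LaurentSeries (ZMod p))
    (hv : LinearIndependent (frobenius (LaurentSeries (ZMod p)) p).fieldRange v) :
    Fintype.card ι ≤ p := by
  have hspan : Submodule.span (frobenius (LaurentSeries (ZMod p)) p).fieldRange
      (Set.range fun e : Fin p => (HahnSeries.single (1 : ℤ) (1 : ZMod p)) ^ (e : ℕ)) = ⊤ :=
    Submodule.eq_top_iff'.mpr fun f => laurentSeries_mem_span_frobenius p f
  haveI : Module.Finite (frobenius (LaurentSeries (ZMod p)) p).fieldRange (LaurentSeries (ZMod p)) := by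
    rw [Module.finite_def, ← hspan]
    exact Submodule.fg_span (Set.finite_range _)
  calc Fintype.card ι
      ≤ Module.finrank (frobenius (LaurentSeries (ZMod p)) p).fieldRange (LaurentSeries (ZMod p)) :=
        hv.fintype_card_le_finrank
    _ ≤ p := by
      have h := finrank_range_le_card (R := (frobenius (LaurentSeries (ZMod p)) p).fieldRange)
        (fun e : Fin p => (HahnSeries.single (1 : ℤ) (1 : ZMod p)) ^ (e : ℕ))
      rw [Set.finrank, hspan, finrank_top, Fintype.card_fin] at h
      exact h

/-! ## Perfect subfields of `𝔽_p((X))` are trivial -/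

/-- A Laurent series over `𝔽_p` admitting `p^n`-th roots for every `n` has order `0`
(`order (y^{p^n}) = p^n · order y`; Mathlib's convention `order 0 = 0` covers `x = 0`). [folklore] -/
theorem laurentSeries_order_eq_zero_of_forall_pow (x : LaurentSeries (ZMod p))
    (hx : ∀ n : ℕ, ∃ y : LaurentSeries (ZMod p), y ^ p ^ n = x) : x.order = 0 := by
  have hp : p.Prime := Fact.out
  set n := x.order.natAbs with hn
  obtain ⟨y, hy⟩ := hx n
  have hdvd : ((p : ℤ) ^ n) ∣ x.order := by
    refine ⟨y.order, ?_⟩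
    rw [← hy, HahnSeries.order_pow, nsmul_eq_mul]
    push_cast
    ring
  refine Int.eq_zero_of_dvd_of_natAbs_lt_natAbs hdvd ?_
  rw [Int.natAbs_pow, Int.natAbs_natCast, ← hn]
  exact Nat.lt_pow_self hp.one_lt

/-- **An element of `𝔽_p((X))` with `p^n`-th roots for all `n` is a constant**: by the previous lemma
`x - x(0)` (which has the same property, `(y - c)^{p^n} = y^{p^n} - c`) would have order `0` if
nonzero, but its constant term vanishes. [folklore] -/
theorem laurentSeries_eq_C_of_forall_pow (x : LaurentSeries (ZMod p))
    (hx : ∀ n : ℕ, ∃ y : LaurentSeries (ZMod p), y ^ p ^ n = x) :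
    x = HahnSeries.C (x.coeff 0) := by
  haveI : CharP (LaurentSeries (ZMod p)) p :=
    charP_of_injective_algebraMap (algebraMap (ZMod p) (LaurentSeries (ZMod p))).injective p
  set c : ZMod p := x.coeff 0 with hc
  rw [← sub_eq_zero]
  by_contra hne
  have hx' : ∀ n : ℕ, ∃ y : LaurentSeries (ZMod p), y ^ p ^ n = x - HahnSeries.C c := by
    intro n
    obtain ⟨y, hy⟩ := hx n
    refine ⟨y - HahnSeries.C c, ?_⟩
    rw [sub_pow_char_pow, hy, ← map_pow, ZMod.pow_card_pow]
  have hord := laurentSeries_order_eq_zero_of_forall_pow p (x - HahnSeries.C c) hx'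
  have hcoeff : (x - HahnSeries.C c).coeff (x - HahnSeries.C c).order = 0 := by
    rw [hord, HahnSeries.coeff_sub, HahnSeries.C_apply, HahnSeries.coeff_single_same, hc, sub_self]
  exact hne (HahnSeries.coeff_order_eq_zero.mp hcoeff)

/-- In a perfect ring every element has a `p^n`-th root for every `n`. [folklore] -/
theorem exists_pow_char_pow_eq_of_perfectRing {R : Type*} [CommRing R] (q : ℕ) [ExpChar R q]
    [PerfectRing R q] (n : ℕ) (a : R) : ∃ y : R, y ^ q ^ n = a := by
  induction n generalizing a with
  | zero => exact ⟨a, by simp⟩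
  | succ n ih =>
    obtain ⟨y, hy⟩ := ih ((frobeniusEquiv R q).symm a)
    refine ⟨y, ?_⟩
    rw [pow_succ, pow_mul, hy, frobeniusEquiv_symm_pow_p]

/-- **Perfect subfields of `𝔽_p((X))` are the prime field**: a ring map from a perfect field `k₀` into
`𝔽_p((X))` takes values in the constants `𝔽_p` (`φ a = C (φ a)(0)`). [cite: Matsumura1987, §26 p. 203] -/
theorem laurentSeries_ringHom_eq_C_of_perfectField {k₀ : Type*} [Field k₀] [PerfectField k₀]
    (φ : k₀ →+* LaurentSeries (ZMod p)) (a : k₀) : φ a = HahnSeries.C ((φ a).coeff 0) := by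
  haveI : CharP (LaurentSeries (ZMod p)) p :=
    charP_of_injective_algebraMap (algebraMap (ZMod p) (LaurentSeries (ZMod p))).injective p
  haveI : CharP k₀ p := φ.charP φ.injective p
  haveI : ExpChar k₀ p := ExpChar.prime Fact.out
  haveI : PerfectRing k₀ p := PerfectField.toPerfectRing p
  refine laurentSeries_eq_C_of_forall_pow p (φ a) fun n => ?_
  obtain ⟨y, hy⟩ := exists_pow_char_pow_eq_of_perfectRing p n a
  exact ⟨φ y, by rw [← map_pow, hy]⟩

end Summit.ResolutionOfSingularities.ResolutionOfSingularities.Theorems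

end
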